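import Summits.Ventures.HodgeRepro2.T5ParabolicBlocks

/-!
# T5IwasawaSplit — the Iwasawa factorisation `G(W_n) = P(Y_n) · K` of the doubled hermitian
# space (blind cell pub-hodge-repro2; support for route/T5-N4-p5.md, N4.3 = (R3), step (P1))

**The objects.** `W` is the hermitian space of `U(W)` with a hermitian involutive Gram matrix
`J` (`Jᴴ = J`, `J * J = 1`; for `U(1,1)`, `J = diag(1, −1) = T5UnitaryBound.J`).  In the
coordinates `Y_n ⊕ Y_n^∇` of the doubled space `W ⊕ W⁻` (`Y_n = {(w, w)}`, `Y_n^∇ = {(w, −w)}`,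
both identified with `W` through `w`) the doubled form is `formHJ J = fromBlocks 0 J J 0`
(the pairing `⟨(y, y), (y′, −y′)⟩ = 2 J(y, y′)`), the majorant is the standard form
(`|y + y′|² + |y − y′|² = 2(|y|² + |y′|²)`), so the maximal compact `K` is
`U(formHJ J) ∩ U(2n)` (`k kᴴ = 1`).  `formHJ 1` is the `formH` of `T5ParabolicBlocks`;
the embedded `i(g, 1)` is `T5ParabolicBlocks.doubling g` (see `T5IwasawaClaim`).

**Main theorem** (`exists_factorisation`): every `x ∈ U(formHJ J)` is `x = fromBlocks A B 0 D · k`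
with `k` unitary, `k ∈ U(formHJ J)` and `fromBlocks A B 0 D ∈ U(formHJ J)` — the Siegel
parabolic times the maximal compact, i.e. the hypotheses `hk` / `hp` / `hx` of
`T5ParabolicBlocks.normSq_det_levi` DISCHARGED (for the correct form).  Proof: for
`x = fromBlocks A B C D` the first block column `(A; C)` is isotropic (`Aᴴ J C + Cᴴ J A = 0`,
`block_relations`) with positive definite Gram matrix `Aᴴ A + Cᴴ C` (`posDef_gram`; `x` is
invertible); the spectral theorem gives `g` with `gᴴ (Aᴴ A + Cᴴ C) g = 1`
(`exists_conjTranspose_mul_mul_eq_one`); `N₁ = A g`, `N₂ = C g` have orthonormal isotropic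
columns; `k = fromBlocks N₁ (J N₂ J) N₂ (J N₁ J)` is unitary (`compact_factor_unitary`) and
commutes with `formHJ J` (`formHJ_mul_compact_factor`); `kᴴ x` has lower-left block
`J gᴴ (Cᴴ J A + Aᴴ J C) = 0`, so `x = k · (kᴴ x)` (`exists_left_factorisation`), and
`x = p · k` follows by inverting (`x⁻¹ = formHJ J · xᴴ · formHJ J`).

Mathlib + own prefix; no sorry; axioms ⊆ {propext, Classical.choice, Quot.sound}.  Honest
scope: the identification of `formHJ J`, `K` and `doubling g` with the printed objects of
[PS-R87] / Liu is the prose of N4.3 (P1) — this file certifies the matrix algebra only.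
-/

namespace Summit.Ventures.HodgeRepro2.T5IwasawaSplit


open Matrix
open scoped ComplexOrder

variable {n : Type*}

/-- The doubled form in the coordinates `Y ⊕ Y^∇`: `fromBlocks 0 J J 0`
(`formHJ 1 = T5ParabolicBlocks.formH`). -/
def formHJ (J : Matrix n n ℂ) : Matrix (n ⊕ n) (n ⊕ n) ℂ := fromBlocks 0 J J 0

/-- `formHJ 1` is the `formH` of `T5ParabolicBlocks`. -/
theorem formHJ_one [DecidableEq n] : formHJ (1 : Matrix n n ℂ) = T5ParabolicBlocks.formH := rfl

/-- `formHJ J` is hermitian when `J` is. -/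
theorem formHJ_conjTranspose {J : Matrix n n ℂ} (hJ : Jᴴ = J) : (formHJ J)ᴴ = formHJ J := by
  simp [formHJ, fromBlocks_conjTranspose, hJ]

/-- `formHJ J` is an involution when `J` is. -/
theorem formHJ_mul_self [Fintype n] [DecidableEq n] {J : Matrix n n ℂ} (hJ2 : J * J = 1) :
    formHJ J * formHJ J = 1 := by
  simp [formHJ, fromBlocks_multiply, hJ2]

/-! ## Generalities on `U(H)` for an arbitrary `H` -/

variable [Fintype n]

/-- `U(H)` is closed under products. -/
theorem preserves_mul (H x y : Matrix (n ⊕ n) (n ⊕ n) ℂ) (hx : xᴴ * H * x = H)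
    (hy : yᴴ * H * y = H) : (x * y)ᴴ * H * (x * y) = H := by
  rw [conjTranspose_mul]
  calc yᴴ * xᴴ * H * (x * y) = yᴴ * (xᴴ * H * x) * y := by
        simp only [Matrix.mul_assoc]
    _ = H := by rw [hx, hy]

/-! ## The block relations of `U(formHJ J)` -/

/-- The four block relations of `xᴴ (formHJ J) x = formHJ J` for `x = fromBlocks A B C D`. -/
theorem block_relations {J A B C D : Matrix n n ℂ}
    (hx : (fromBlocks A B C D)ᴴ * formHJ J * fromBlocks A B C D = formHJ J) :
    Aᴴ * J * C + Cᴴ * J * A = 0 ∧ Aᴴ * J * D + Cᴴ * J * B = J ∧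
      Bᴴ * J * C + Dᴴ * J * A = J ∧ Bᴴ * J * D + Dᴴ * J * B = 0 := by
  simp only [formHJ, fromBlocks_conjTranspose, fromBlocks_multiply, Matrix.mul_zero,
    zero_add, add_zero, Matrix.mul_assoc] at hx
  rw [fromBlocks_inj] at hx
  obtain ⟨h11, h12, h21, h22⟩ := hx
  refine ⟨?_, ?_, ?_, ?_⟩ <;> rw [add_comm] <;> simpa only [Matrix.mul_assoc]

/-- The parabolic relations for `formHJ J`: `Aᴴ J D = J`, `Dᴴ J A = J`, `Bᴴ J D + Dᴴ J B = 0`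
(«`D_p = J (A_p*)⁻¹ J`»). -/
theorem parabolic_relations {J A B D : Matrix n n ℂ}
    (hp : (fromBlocks A B 0 D)ᴴ * formHJ J * fromBlocks A B 0 D = formHJ J) :
    Aᴴ * J * D = J ∧ Dᴴ * J * A = J ∧ Bᴴ * J * D + Dᴴ * J * B = 0 := by
  obtain ⟨-, h12, h21, h22⟩ := block_relations hp
  simp only [Matrix.mul_zero, Matrix.zero_mul, add_zero, zero_add, conjTranspose_zero]
    at h12 h21 h22
  exact ⟨h12, h21, h22⟩

/-- Conjugation by a hermitian `J` commutes with `ᴴ`. -/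
theorem conjTranspose_conj {J : Matrix n n ℂ} (hJ : Jᴴ = J) (M : Matrix n n ℂ) :
    (J * M * J)ᴴ = J * Mᴴ * J := by
  simp only [conjTranspose_mul, hJ, Matrix.mul_assoc]

/-! ## Inverses in `U(H)` -/

variable [DecidableEq n]

/-- A right inverse of an element of `U(H)` lies in `U(H)` (no hypothesis on `H`). -/
theorem preserves_of_mul_eq_one (H x q : Matrix (n ⊕ n) (n ⊕ n) ℂ) (hx : xᴴ * H * x = H)
    (hq : x * q = 1) : qᴴ * H * q = H := by
  calc qᴴ * H * q = qᴴ * (xᴴ * H * x) * q := by rw [hx]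
    _ = (x * q)ᴴ * H * (x * q) := by simp only [conjTranspose_mul, Matrix.mul_assoc]
    _ = H := by rw [hq]; simp

/-- For a hermitian involution `H`, `H xᴴ H` is a two-sided inverse of `x ∈ U(H)`. -/
theorem inv_mul_of_preserves (H x : Matrix (n ⊕ n) (n ⊕ n) ℂ) (hH2 : H * H = 1)
    (hx : xᴴ * H * x = H) : (H * xᴴ * H) * x = 1 := by
  calc (H * xᴴ * H) * x = H * (xᴴ * H * x) := by simp only [Matrix.mul_assoc]
    _ = 1 := by rw [hx, hH2]

/-- `x ∈ U(H)` is a unit when `H` is an involution. -/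
theorem isUnit_of_preserves (H x : Matrix (n ⊕ n) (n ⊕ n) ℂ) (hH2 : H * H = 1)
    (hx : xᴴ * H * x = H) : IsUnit x :=
  IsUnit.of_mul_eq_one _ (mul_eq_one_comm.1 (inv_mul_of_preserves H x hH2 hx))

/-- The inverse `H xᴴ H` of `x ∈ U(H)` lies in `U(H)` (`H` a hermitian involution). -/
theorem inv_preserves (H x : Matrix (n ⊕ n) (n ⊕ n) ℂ) (hH2 : H * H = 1)
    (hx : xᴴ * H * x = H) : (H * xᴴ * H)ᴴ * H * (H * xᴴ * H) = H :=
  preserves_of_mul_eq_one H x _ hx (mul_eq_one_comm.1 (inv_mul_of_preserves H x hH2 hx))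

/-! ## A «square root»: `gᴴ G g = 1` for a positive definite `G` (spectral theorem) -/

/-- For a positive definite `G` there is an invertible `g` with `gᴴ G g = 1`
(`g = U · diag(λ_i^{−1/2})` from the spectral theorem `G = U diag(λ) Uᴴ`). -/
theorem exists_conjTranspose_mul_mul_eq_one {G : Matrix n n ℂ} (hG : G.PosDef) :
    ∃ g : Matrix n n ℂ, IsUnit g ∧ gᴴ * G * g = 1 := by
  have hH : G.IsHermitian := hG.1
  have hlam : ∀ i, 0 < hH.eigenvalues i := hG.eigenvalues_pos
  set U : Matrix n n ℂ := (hH.eigenvectorUnitary : Matrix n n ℂ) with hU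
  set r : n → ℂ := fun i => (((Real.sqrt (hH.eigenvalues i))⁻¹ : ℝ) : ℂ) with hr
  have hUU : Uᴴ * U = 1 := by
    have := Matrix.UnitaryGroup.star_mul_self hH.eigenvectorUnitary
    simpa only [star_eq_conjTranspose] using this
  have hspec : G = U * diagonal (RCLike.ofReal ∘ hH.eigenvalues) * Uᴴ := by
    have := hH.spectral_theorem
    rw [Unitary.conjStarAlgAut_apply] at this
    simpa only [star_eq_conjTranspose] using this
  refine ⟨U * diagonal r, ?_, ?_⟩
  · refine IsUnit.mul (IsUnit.of_mul_eq_one _ (mul_eq_one_comm.1 hUU)) ?_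
    rw [Matrix.isUnit_iff_isUnit_det, det_diagonal]
    refine IsUnit.mk0 _ (Finset.prod_ne_zero_iff.2 fun i _ => ?_)
    simp only [hr, ne_eq, Complex.ofReal_eq_zero, inv_eq_zero]
    exact (Real.sqrt_pos.2 (hlam i)).ne'
  · rw [conjTranspose_mul, diagonal_conjTranspose, hspec]
    simp only [Matrix.mul_assoc]
    rw [← Matrix.mul_assoc Uᴴ U, hUU, Matrix.one_mul, ← Matrix.mul_assoc Uᴴ U, hUU,
      Matrix.one_mul, diagonal_mul_diagonal, diagonal_mul_diagonal, ← diagonal_one]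
    congr 1
    funext i
    have h0 : Real.sqrt (hH.eigenvalues i) ≠ 0 := (Real.sqrt_pos.2 (hlam i)).ne'
    have hsq : Real.sqrt (hH.eigenvalues i) * Real.sqrt (hH.eigenvalues i) = hH.eigenvalues i :=
      Real.mul_self_sqrt (hlam i).le
    simp only [hr, Pi.star_apply, Function.comp_apply, Complex.star_def, Complex.conj_ofReal]
    have hsqC : (Real.sqrt (hH.eigenvalues i) : ℂ) * (Real.sqrt (hH.eigenvalues i) : ℂ) =
        (hH.eigenvalues i : ℂ) := by exact_mod_cast hsq
    have h0C : (Real.sqrt (hH.eigenvalues i) : ℂ) ≠ 0 := by exact_mod_cast h0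
    have hcast : (RCLike.ofReal (hH.eigenvalues i) : ℂ) = ((hH.eigenvalues i : ℝ) : ℂ) := rfl
    rw [Complex.ofReal_inv, hcast, ← hsqC]
    field_simp

/-! ## The Gram matrix of the first block column -/

/-- The Gram matrix `Aᴴ A + Cᴴ C` of the first block column of an invertible block matrix is
positive definite. -/
theorem posDef_gram {A B C D : Matrix n n ℂ} (hx : IsUnit (fromBlocks A B C D)) :
    (Aᴴ * A + Cᴴ * C).PosDef := by
  have h : (fromRows A C)ᴴ * fromRows A C = Aᴴ * A + Cᴴ * C := by
    rw [conjTranspose_fromRows_eq_fromCols_conjTranspose, fromCols_mul_fromRows]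
  rw [← h]
  apply Matrix.PosDef.conjTranspose_mul_self
  intro v w hvw
  rw [fromRows_mulVec, fromRows_mulVec] at hvw
  have hinj : Function.Injective (fromBlocks A B C D).mulVec := mulVec_injective_iff_isUnit.2 hx
  have hsum : fromBlocks A B C D *ᵥ Sum.elim v 0 = fromBlocks A B C D *ᵥ Sum.elim w 0 := by
    rw [fromBlocks_mulVec, fromBlocks_mulVec]
    simp only [Sum.elim_comp_inl, Sum.elim_comp_inr, mulVec_zero, add_zero]
    exact hvw
  have hvw' := hinj hsum
  funext i
  simpa using congr_fun hvw' (Sum.inl i)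

/-! ## The Iwasawa factorisation `x = k · p` -/

/-- `k = fromBlocks N₁ (J N₂ J) N₂ (J N₁ J)` is unitary when the columns of `(N₁; N₂)` are
orthonormal and isotropic for `formHJ J`. -/
theorem compact_factor_unitary {J N₁ N₂ : Matrix n n ℂ} (hJ : Jᴴ = J) (hJ2 : J * J = 1)
    (horth : N₁ᴴ * N₁ + N₂ᴴ * N₂ = 1) (hiso : N₁ᴴ * J * N₂ + N₂ᴴ * J * N₁ = 0) :
    (fromBlocks N₁ (J * N₂ * J) N₂ (J * N₁ * J))ᴴ * fromBlocks N₁ (J * N₂ * J) N₂ (J * N₁ * J)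
      = 1 := by
  have e12 : N₁ᴴ * (J * N₂ * J) + N₂ᴴ * (J * N₁ * J) = 0 := by
    calc N₁ᴴ * (J * N₂ * J) + N₂ᴴ * (J * N₁ * J)
        = (N₁ᴴ * J * N₂ + N₂ᴴ * J * N₁) * J := by
          simp only [Matrix.add_mul, Matrix.mul_assoc]
      _ = 0 := by rw [hiso, Matrix.zero_mul]
  have e21 : (J * N₂ * J)ᴴ * N₁ + (J * N₁ * J)ᴴ * N₂ = 0 := by
    rw [conjTranspose_conj hJ, conjTranspose_conj hJ]
    calc J * N₂ᴴ * J * N₁ + J * N₁ᴴ * J * N₂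
        = J * (N₁ᴴ * J * N₂ + N₂ᴴ * J * N₁) := by
          simp only [Matrix.mul_add, Matrix.mul_assoc, add_comm]
      _ = 0 := by rw [hiso, Matrix.mul_zero]
  have e22 : (J * N₂ * J)ᴴ * (J * N₂ * J) + (J * N₁ * J)ᴴ * (J * N₁ * J) = 1 := by
    rw [conjTranspose_conj hJ, conjTranspose_conj hJ]
    calc J * N₂ᴴ * J * (J * N₂ * J) + J * N₁ᴴ * J * (J * N₁ * J)
        = J * (N₁ᴴ * (J * J) * N₁ + N₂ᴴ * (J * J) * N₂) * J := by
          simp only [Matrix.mul_add, Matrix.add_mul, Matrix.mul_assoc, add_comm]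
      _ = 1 := by rw [hJ2, Matrix.mul_one, Matrix.mul_one, horth, Matrix.mul_one, hJ2]
  rw [fromBlocks_conjTranspose, fromBlocks_multiply, horth, e12, e21, e22, fromBlocks_one]

/-- `k = fromBlocks N₁ (J N₂ J) N₂ (J N₁ J)` commutes with `formHJ J`. -/
theorem formHJ_mul_compact_factor {J N₁ N₂ : Matrix n n ℂ} (hJ2 : J * J = 1) :
    formHJ J * fromBlocks N₁ (J * N₂ * J) N₂ (J * N₁ * J)
      = fromBlocks N₁ (J * N₂ * J) N₂ (J * N₁ * J) * formHJ J := by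
  have hJJ : ∀ M : Matrix n n ℂ, J * (J * M) = M := fun M => by
    rw [← Matrix.mul_assoc, hJ2, Matrix.one_mul]
  simp only [formHJ, fromBlocks_multiply, Matrix.zero_mul, Matrix.mul_zero, zero_add, add_zero,
    Matrix.mul_assoc, hJJ, hJ2, Matrix.mul_one]

/-- **Iwasawa, left form.** Every `x ∈ U(formHJ J)` (`J` a hermitian involution) is
`x = k · fromBlocks A′ B′ 0 D′` with `k ∈ U(formHJ J)` unitary and the second factor in the
Siegel parabolic `P(Y_n) ∩ U(formHJ J)`. -/
theorem exists_left_factorisation {J : Matrix n n ℂ} (hJ : Jᴴ = J) (hJ2 : J * J = 1)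
    {x : Matrix (n ⊕ n) (n ⊕ n) ℂ} (hx : xᴴ * formHJ J * x = formHJ J) :
    ∃ (k : Matrix (n ⊕ n) (n ⊕ n) ℂ) (A' B' D' : Matrix n n ℂ),
      k * kᴴ = 1 ∧ kᴴ * formHJ J * k = formHJ J ∧
      (fromBlocks A' B' 0 D')ᴴ * formHJ J * fromBlocks A' B' 0 D' = formHJ J ∧
      x = k * fromBlocks A' B' 0 D' := by
  obtain ⟨A, B, C, D, rfl⟩ : ∃ A B C D, x = fromBlocks A B C D :=
    ⟨_, _, _, _, (fromBlocks_toBlocks x).symm⟩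
  have hunit : IsUnit (fromBlocks A B C D) := isUnit_of_preserves _ _ (formHJ_mul_self hJ2) hx
  obtain ⟨h11, -, -, -⟩ := block_relations hx
  obtain ⟨g, -, hgG⟩ := exists_conjTranspose_mul_mul_eq_one (posDef_gram hunit)
  have horth : (A * g)ᴴ * (A * g) + (C * g)ᴴ * (C * g) = 1 := by
    rw [conjTranspose_mul, conjTranspose_mul, ← hgG]
    simp only [Matrix.mul_add, Matrix.add_mul, Matrix.mul_assoc]
  have hiso : (A * g)ᴴ * J * (C * g) + (C * g)ᴴ * J * (A * g) = 0 := by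
    rw [conjTranspose_mul, conjTranspose_mul]
    calc gᴴ * Aᴴ * J * (C * g) + gᴴ * Cᴴ * J * (A * g)
        = gᴴ * (Aᴴ * J * C + Cᴴ * J * A) * g := by
          simp only [Matrix.mul_add, Matrix.add_mul, Matrix.mul_assoc]
      _ = 0 := by rw [h11, Matrix.mul_zero, Matrix.zero_mul]
  set k := fromBlocks (A * g) (J * (C * g) * J) (C * g) (J * (A * g) * J) with hk
  have hkk : kᴴ * k = 1 := compact_factor_unitary hJ hJ2 horth hiso
  have hkk' : k * kᴴ = 1 := mul_eq_one_comm.1 hkk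
  have hkH : kᴴ * formHJ J * k = formHJ J := by
    rw [Matrix.mul_assoc, formHJ_mul_compact_factor hJ2, ← Matrix.mul_assoc, hkk, Matrix.one_mul]
  -- the parabolic factor `p = kᴴ x`
  have hp21 : (kᴴ * fromBlocks A B C D).toBlocks₂₁ = 0 := by
    rw [hk, fromBlocks_conjTranspose, fromBlocks_multiply, toBlocks_fromBlocks₂₁,
      conjTranspose_conj hJ, conjTranspose_conj hJ, conjTranspose_mul, conjTranspose_mul]
    calc J * (gᴴ * Cᴴ) * J * A + J * (gᴴ * Aᴴ) * J * C
        = J * gᴴ * (Aᴴ * J * C + Cᴴ * J * A) := by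
          simp only [Matrix.mul_add, Matrix.mul_assoc, add_comm]
      _ = 0 := by rw [h11, Matrix.mul_zero]
  have hpH : (kᴴ * fromBlocks A B C D)ᴴ * formHJ J * (kᴴ * fromBlocks A B C D) = formHJ J :=
    preserves_mul _ _ _ (preserves_of_mul_eq_one _ _ _ hkH hkk') hx
  have hpblocks : kᴴ * fromBlocks A B C D =
      fromBlocks (kᴴ * fromBlocks A B C D).toBlocks₁₁ (kᴴ * fromBlocks A B C D).toBlocks₁₂ 0
        (kᴴ * fromBlocks A B C D).toBlocks₂₂ := by
    rw [← hp21]; exact (fromBlocks_toBlocks _).symm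
  refine ⟨k, (kᴴ * fromBlocks A B C D).toBlocks₁₁, (kᴴ * fromBlocks A B C D).toBlocks₁₂,
    (kᴴ * fromBlocks A B C D).toBlocks₂₂, hkk', hkH, ?_, ?_⟩
  · rw [← hpblocks]; exact hpH
  · rw [← hpblocks, ← Matrix.mul_assoc, hkk', Matrix.one_mul]

/-! ## The Iwasawa factorisation `x = p · k` (the form used by the CLAIM) -/

omit [DecidableEq n] in
/-- The inverse `H pᴴ H` of a Siegel-parabolic element is block upper triangular:
`formHJ J · (fromBlocks A B 0 D)ᴴ · formHJ J = fromBlocks (J Dᴴ J) (J Bᴴ J) 0 (J Aᴴ J)`. -/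
theorem formHJ_conjTranspose_parabolic_formHJ (J A B D : Matrix n n ℂ) :
    formHJ J * (fromBlocks A B 0 D)ᴴ * formHJ J =
      fromBlocks (J * Dᴴ * J) (J * Bᴴ * J) 0 (J * Aᴴ * J) := by
  simp only [formHJ, fromBlocks_conjTranspose, fromBlocks_multiply, Matrix.zero_mul,
    Matrix.mul_zero, zero_add, add_zero, conjTranspose_zero]

/-- **Iwasawa factorisation** `G(W_n) = P(Y_n) · K` for the doubled form `formHJ J`
(`J` a hermitian involution): every `x ∈ U(formHJ J)` is `x = fromBlocks A B 0 D · k` with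
`k` unitary, `k ∈ U(formHJ J)` and `fromBlocks A B 0 D ∈ U(formHJ J)` — exactly the hypotheses
`hk`, `hp`, `hx` of `T5ParabolicBlocks.normSq_det_levi`, now with the correct form. -/
theorem exists_factorisation {J : Matrix n n ℂ} (hJ : Jᴴ = J) (hJ2 : J * J = 1)
    {x : Matrix (n ⊕ n) (n ⊕ n) ℂ} (hx : xᴴ * formHJ J * x = formHJ J) :
    ∃ (A B D : Matrix n n ℂ) (k : Matrix (n ⊕ n) (n ⊕ n) ℂ),
      k * kᴴ = 1 ∧ kᴴ * formHJ J * k = formHJ J ∧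
      (fromBlocks A B 0 D)ᴴ * formHJ J * fromBlocks A B 0 D = formHJ J ∧
      x = fromBlocks A B 0 D * k := by
  have hH2 := formHJ_mul_self (n := n) hJ2
  -- the inverse `q = H xᴴ H` of `x`
  set q := formHJ J * xᴴ * formHJ J with hq
  have hqx : q * x = 1 := inv_mul_of_preserves _ _ hH2 hx
  have hxq : x * q = 1 := mul_eq_one_comm.1 hqx
  have hqH : qᴴ * formHJ J * q = formHJ J := inv_preserves _ _ hH2 hx
  obtain ⟨k, A', B', D', hkk, hkH, hpH, hqkp⟩ := exists_left_factorisation hJ hJ2 hqH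
  set p := fromBlocks A' B' 0 D' with hp
  -- the inverse of `p`
  have hpinv : p * (formHJ J * pᴴ * formHJ J) = 1 :=
    mul_eq_one_comm.1 (inv_mul_of_preserves _ _ hH2 hpH)
  have hpinvH : (formHJ J * pᴴ * formHJ J)ᴴ * formHJ J * (formHJ J * pᴴ * formHJ J) = formHJ J :=
    inv_preserves _ _ hH2 hpH
  have hkinvH : (kᴴ)ᴴ * formHJ J * kᴴ = formHJ J := preserves_of_mul_eq_one _ _ _ hkH hkk
  -- `x = p⁻¹ · k⁻¹`
  have hxeq : x = (formHJ J * pᴴ * formHJ J) * kᴴ := by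
    calc x = x * (q * ((formHJ J * pᴴ * formHJ J) * kᴴ)) := by
          rw [hqkp, Matrix.mul_assoc k p, ← Matrix.mul_assoc p, hpinv, Matrix.one_mul, hkk,
            Matrix.mul_one]
      _ = (formHJ J * pᴴ * formHJ J) * kᴴ := by rw [← Matrix.mul_assoc, hxq, Matrix.one_mul]
  rw [hp, formHJ_conjTranspose_parabolic_formHJ] at hxeq hpinvH
  refine ⟨J * D'ᴴ * J, J * B'ᴴ * J, J * A'ᴴ * J, kᴴ, ?_, hkinvH, hpinvH, hxeq⟩
  rw [conjTranspose_conjTranspose]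
  exact mul_eq_one_comm.1 hkk

end Summit.Ventures.HodgeRepro2.T5IwasawaSplit
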